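import Summits.Ventures.HSemireg.WedgeHankelPairMixingImage

/-!
# Venture HSemireg — PAIR SWAPS RELABEL THE COORDINATE PROJECTIONS: `Pm(swap a b)` is an involution carrying `Sp(pairs ⊆ T)` onto `Sp(pairs ⊆ swap(T))`, so for every
# swap-stable subspace `W` (every kernel and image of th-7's class) `dim (W ⊓ Sp(pairs ⊆ T))` DEPENDS ON `|T|` ONLY; hence the dimension of the image `Pm(M)(Kr)` of a kernel
# under a pair mixing depends only on `rank M`

HONEST FRAMING. Part of the Lean index of the computation cell `pub-hsemireg` (seat p10 gen 22, Sunday typer «UNIFORM-IN-n»).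
Finite-dimensional EXTERIOR ALGEBRA over a field ONLY: no variety, no cohomology theory, no sheaf, no Ext group, no semiregularity map;
nothing here says that HC / HC_CM / HC_AV holds; no Literature fact is declared or used.  Custodian versions as in `WedgeHankelSiegelIdeal` (1/3); the dictionary (the pairs
`(x_a, y_a)` = the `N` factors; `Sp(pairs ⊆ T)` = the forms living on the sub-product over `T`; a pair mixing of rank `r` = a correspondence onto an `r`-dimensional factor) is
QUOTED, never asserted.

WHAT IS IN THE TREE.  H9 (`WedgeHankelPairMixing`): `Pm M`, `Pm_mul`, the pair swaps `swapMat a b` with `Pm_swapMat_X` / `_Y`; I5 (`…PairMixingKernel`): **`Pm_mem_Kr_w` / `Pm_mem_V_w`**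
(every kernel / image of th-7's class is stable under EVERY `Pm M`); J6 (`…PairMixingProjection`): **`Pm_diagonal_indicator_apply`** (`Pm(diagonal 1_T) = proj_{pairs ⊆ T}`),
`map_Pm_indicator_Kr_w` (`Pm(1_T)(Kr) = Kr ⊓ Sp(pairs ⊆ T)`); J14 (`…PairMixingImage`): **`exists_finrank_map_Pm_Kr_w_eq`** (`dim Pm(M)(Kr) = dim (Kr ⊓ Sp(pairs ⊆ T))` for SOME `T`
with `|T| = rank M`); w3 `proj_eq_self` / `proj_mem`; H1 `algHom_ext_XY`.  Gen 20/21 CLOSE §OPEN (c): «`dim (Kr ⊓ Sp(pairs ⊆ T))` depends on `|T|` only».  THIS FILE (namespace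
`Summit.Ventures.HSemireg.Wedge.HankelPairMixing` continued; imports J14):
* §324 `Pm_swapMat_comp_self` (`Pm(swap)² = id`), `Pm_swapMat_swapMat_apply`, `Pm_swapMat_injective`, **`diagonal_comp_swap_mul_swapMat`** (`diagonal(d ∘ swap)·swapMat =
  swapMat·diagonal d`), `Pm_swapMat_comp_Pm_diagonal`, `indicator_comp_swap`.
* §325 **`mem_Sp_pairs_iff_Pm_indicator_eq`** (`θ ∈ Sp(pairs ⊆ T) ⇔ Pm(1_T) θ = θ`), **`Pm_swapMat_mem_Sp_pairs`** (`Pm(swap a b)` maps `Sp(pairs ⊆ T)` into `Sp(pairs ⊆ swap(T))`),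
  `image_swap_image_swap`, **`map_Pm_swapMat_Sp_pairs`** (`=`), **`map_Pm_swapMat_inf_Sp_pairs`** (`Pm(swap)(W ⊓ Sp(pairs ⊆ T)) = W ⊓ Sp(pairs ⊆ swap T)` for swap-stable `W`),
  **`finrank_inf_Sp_pairs_swap`**.
* §326 `image_swap_eq_insert_erase`, `card_sdiff_comm`, **`finrank_inf_Sp_pairs_eq_of_card_eq`: for `W` stable under all pair swaps, `dim (W ⊓ Sp(pairs ⊆ T)) = dim (W ⊓ Sp(pairs ⊆ T′))`
  whenever `|T| = |T′|`** (move `T` to `T′` one swap at a time), **`finrank_Kr_w_inf_Sp_pairs_eq_of_card_eq`** / **`finrank_V_w_inf_Sp_pairs_eq_of_card_eq`** (th-7's kernels and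
  images), and **`finrank_map_Pm_Kr_w_eq_of_rank_eq`: `dim Pm(M)(Kr(univ, w_N q, k)) = dim Pm(M′)(Kr(univ, w_N q, k))` whenever `rank M = rank M′`** (J14 + §326).
NOT typed here: the value of `dim (Kr ⊓ Sp(pairs ⊆ T))` as a function of `|T|` (I10's fibre sums give it for the Hankel kernels); general permutation matrices (swaps suffice);
anything Ext-side.  Class side only; new names only.
-/

open Module

namespace Summit.Ventures.HSemireg.Wedge.HankelPairMixing

open Summit.Ventures.HSemireg.Wedge Summit.Ventures.HSemireg.Wedge.Kunneth Summit.Ventures.HSemireg.Wedge.Hankel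
  Summit.Ventures.HSemireg.Wedge.KunnethKernel Summit.Ventures.HSemireg.Wedge.Weil Summit.Ventures.HSemireg.Wedge.HankelPairGrading
  Summit.Ventures.HSemireg.Wedge.HankelFrameChange

variable (K : Type*) [Field K] {N : ℕ}

/-! ## §324. Pair swaps are involutions, and they relabel the diagonal mixings -/

/-- **`Pm(swap a b) ∘ Pm(swap a b) = id`** (checked on the letters). -/
theorem Pm_swapMat_comp_self (a b : Fin N) : (Pm K (swapMat K a b)).comp (Pm K (swapMat K (n := N) a b)) = AlgHom.id K (HT K (In N)) :=
  algHom_ext_XY K (fun c => by rw [AlgHom.comp_apply, Pm_swapMat_X, Pm_swapMat_X, Equiv.swap_apply_self, AlgHom.id_apply])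
    (fun c => by rw [AlgHom.comp_apply, Pm_swapMat_Y, Pm_swapMat_Y, Equiv.swap_apply_self, AlgHom.id_apply])

/-- `Pm(swap a b) (Pm(swap a b) θ) = θ`. -/
theorem Pm_swapMat_swapMat_apply (a b : Fin N) (θ : HT K (In N)) : Pm K (swapMat K a b) (Pm K (swapMat K a b) θ) = θ := by
  rw [← AlgHom.comp_apply, Pm_swapMat_comp_self, AlgHom.id_apply]

/-- `Pm(swap a b)` is injective. -/
theorem Pm_swapMat_injective (a b : Fin N) : Function.Injective (Pm K (swapMat K (n := N) a b)) :=
  Function.LeftInverse.injective (Pm_swapMat_swapMat_apply K a b)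

/-- **the matrix identity `diagonal (d ∘ swap a b) · swapMat a b = swapMat a b · diagonal d`** (a permutation matrix conjugates a diagonal matrix to the relabelled one). -/
theorem diagonal_comp_swap_mul_swapMat (a b : Fin N) (d : Fin N → K) :
    Matrix.diagonal (fun c => d (Equiv.swap a b c)) * swapMat K a b = swapMat K a b * Matrix.diagonal d := by
  ext i j
  rw [Matrix.diagonal_mul, Matrix.mul_diagonal]
  simp only [swapMat, Matrix.of_apply]
  by_cases h : i = Equiv.swap a b j
  · rw [if_pos h, mul_one, one_mul, h, Equiv.swap_apply_self]
  · rw [if_neg h, mul_zero, zero_mul]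

/-- hence **`Pm(swap a b) ∘ Pm(diagonal d) = Pm(diagonal (d ∘ swap a b)) ∘ Pm(swap a b)`** (`Pm_mul`). -/
theorem Pm_swapMat_comp_Pm_diagonal (a b : Fin N) (d : Fin N → K) :
    (Pm K (swapMat K a b)).comp (Pm K (Matrix.diagonal d)) = (Pm K (Matrix.diagonal fun c => d (Equiv.swap a b c))).comp (Pm K (swapMat K (n := N) a b)) := by
  rw [← Pm_mul, ← Pm_mul, diagonal_comp_swap_mul_swapMat]

omit [Field K] in
/-- the indicator of `T` relabelled by a swap is the indicator of the swapped set. -/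
theorem indicator_comp_swap (K : Type*) [Field K] (a b : Fin N) (T : Finset (Fin N)) :
    (fun c => if Equiv.swap a b c ∈ T then (1 : K) else 0) = fun c => if c ∈ T.image (Equiv.swap a b) then (1 : K) else 0 := by
  funext c
  have h : Equiv.swap a b c ∈ T ↔ c ∈ T.image (Equiv.swap a b) := by
    rw [Finset.mem_image]
    constructor
    · intro h; exact ⟨_, h, by rw [Equiv.swap_apply_self]⟩
    · rintro ⟨c', hc', rfl⟩; rwa [Equiv.swap_apply_self]
  simp only [h]

/-! ## §325. A pair swap carries `Sp(pairs ⊆ T)` onto `Sp(pairs ⊆ swap T)` -/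

/-- **`θ ∈ Sp(pairs ⊆ T) ⇔ Pm(diagonal 1_T) θ = θ`** (J6: `Pm(1_T)` is the projection onto `Sp(pairs ⊆ T)`). -/
theorem mem_Sp_pairs_iff_Pm_indicator_eq (T : Finset (Fin N)) (θ : HT K (In N)) :
    θ ∈ Sp K (fun s : Finset (In N) => ∀ i ∈ s, pr i ∈ T) ↔ Pm K (Matrix.diagonal fun c => if c ∈ T then (1 : K) else 0) θ = θ := by
  classical
  rw [Pm_diagonal_indicator_apply]
  constructor
  · intro h; exact proj_eq_self (fun s hs => hs) h
  · intro h; rw [← h]; exact proj_mem _ θ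

/-- **`Pm(swap a b)` maps `Sp(pairs ⊆ T)` into `Sp(pairs ⊆ swap(T))`**: `Pm(1_{swap T}) (Pm(swap) θ) = Pm(swap) (Pm(1_T) θ) = Pm(swap) θ`. -/
theorem Pm_swapMat_mem_Sp_pairs (a b : Fin N) (T : Finset (Fin N)) {θ : HT K (In N)} (hθ : θ ∈ Sp K (fun s : Finset (In N) => ∀ i ∈ s, pr i ∈ T)) :
    Pm K (swapMat K a b) θ ∈ Sp K (fun s : Finset (In N) => ∀ i ∈ s, pr i ∈ T.image (Equiv.swap a b)) := by
  rw [mem_Sp_pairs_iff_Pm_indicator_eq] at hθ ⊢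
  have h := congrArg (fun F : HT K (In N) →ₐ[K] HT K (In N) => F θ) (Pm_swapMat_comp_Pm_diagonal K a b (fun c => if c ∈ T then (1 : K) else 0))
  simp only [AlgHom.comp_apply, hθ] at h
  rw [indicator_comp_swap K a b T] at h
  exact h.symm

/-- swapping twice: `swap(swap(T)) = T`. -/
theorem image_swap_image_swap (a b : Fin N) (T : Finset (Fin N)) : (T.image (Equiv.swap a b)).image (Equiv.swap a b) = T := by
  rw [Finset.image_image]
  have h : (Equiv.swap a b : Fin N → Fin N) ∘ (Equiv.swap a b) = id := funext fun c => Equiv.swap_apply_self a b c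
  rw [h, Finset.image_id]

/-- **`Pm(swap a b)(Sp(pairs ⊆ T)) = Sp(pairs ⊆ swap(T))`.** -/
theorem map_Pm_swapMat_Sp_pairs (a b : Fin N) (T : Finset (Fin N)) :
    (Sp K (fun s : Finset (In N) => ∀ i ∈ s, pr i ∈ T)).map (Pm K (swapMat K a b)).toLinearMap = Sp K (fun s : Finset (In N) => ∀ i ∈ s, pr i ∈ T.image (Equiv.swap a b)) := by
  apply le_antisymm
  · rintro _ ⟨θ, hθ, rfl⟩
    exact Pm_swapMat_mem_Sp_pairs K a b T hθ
  · intro θ hθ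
    refine ⟨Pm K (swapMat K a b) θ, ?_, Pm_swapMat_swapMat_apply K a b θ⟩
    have h := Pm_swapMat_mem_Sp_pairs K a b _ hθ
    rwa [image_swap_image_swap] at h

/-- **for a swap-stable subspace `W`: `Pm(swap a b)(W ⊓ Sp(pairs ⊆ T)) = W ⊓ Sp(pairs ⊆ swap(T))`.** -/
theorem map_Pm_swapMat_inf_Sp_pairs {a b : Fin N} {W : Submodule K (HT K (In N))} (hW : ∀ θ ∈ W, Pm K (swapMat K a b) θ ∈ W) (T : Finset (Fin N)) :
    (W ⊓ Sp K (fun s : Finset (In N) => ∀ i ∈ s, pr i ∈ T)).map (Pm K (swapMat K a b)).toLinearMap =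
      W ⊓ Sp K (fun s : Finset (In N) => ∀ i ∈ s, pr i ∈ T.image (Equiv.swap a b)) := by
  apply le_antisymm
  · rintro _ ⟨θ, ⟨hθW, hθT⟩, rfl⟩
    exact ⟨hW θ hθW, Pm_swapMat_mem_Sp_pairs K a b T hθT⟩
  · rintro θ ⟨hθW, hθT⟩
    refine ⟨Pm K (swapMat K a b) θ, ⟨hW θ hθW, ?_⟩, Pm_swapMat_swapMat_apply K a b θ⟩
    have h := Pm_swapMat_mem_Sp_pairs K a b _ hθT
    rwa [image_swap_image_swap] at h

/-- **hence `dim (W ⊓ Sp(pairs ⊆ T)) = dim (W ⊓ Sp(pairs ⊆ swap(T)))` for every swap-stable `W`** (`Pm(swap)` is injective). -/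
theorem finrank_inf_Sp_pairs_swap {a b : Fin N} {W : Submodule K (HT K (In N))} (hW : ∀ θ ∈ W, Pm K (swapMat K a b) θ ∈ W) (T : Finset (Fin N)) :
    finrank K ↥(W ⊓ Sp K (fun s : Finset (In N) => ∀ i ∈ s, pr i ∈ T)) = finrank K ↥(W ⊓ Sp K (fun s : Finset (In N) => ∀ i ∈ s, pr i ∈ T.image (Equiv.swap a b))) := by
  rw [← map_Pm_swapMat_inf_Sp_pairs K hW T]
  exact (Submodule.equivMapOfInjective _ (fun x y h => Pm_swapMat_injective K a b h) _).finrank_eq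

/-! ## §326. The dimension depends on `|T|` only -/

omit [Field K] in
/-- swapping `a ∈ T` with `b ∉ T`: `swap(T) = insert b (T \ {a})`. -/
theorem image_swap_eq_insert_erase {T : Finset (Fin N)} {a b : Fin N} (ha : a ∈ T) (hb : b ∉ T) : T.image (Equiv.swap a b) = insert b (T.erase a) := by
  ext c
  simp only [Finset.mem_image, Finset.mem_insert, Finset.mem_erase]
  constructor
  · rintro ⟨x, hx, rfl⟩
    by_cases hxa : x = a
    · left; rw [hxa, Equiv.swap_apply_left]
    · right
      have hxb : x ≠ b := fun h => hb (h ▸ hx)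
      rw [Equiv.swap_apply_of_ne_of_ne hxa hxb]
      exact ⟨hxa, hx⟩
  · rintro (rfl | ⟨hca, hc⟩)
    · exact ⟨a, ha, Equiv.swap_apply_left a c⟩
    · exact ⟨c, hc, Equiv.swap_apply_of_ne_of_ne hca fun h => hb (h ▸ hc)⟩

omit [Field K] in
/-- equal cards ⇒ the two differences have equal cards. -/
theorem card_sdiff_comm {T T' : Finset (Fin N)} (h : T.card = T'.card) : (T \ T').card = (T' \ T).card := by
  have h1 := Finset.card_sdiff_add_card_inter T T'
  have h2 := Finset.card_sdiff_add_card_inter T' T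
  rw [Finset.inter_comm] at h2
  omega

/-- **`dim (W ⊓ Sp(pairs ⊆ T))` DEPENDS ON `|T|` ONLY, for every subspace `W` stable under all pair swaps** — move `T` onto `T′` one transposition at a time (`a ∈ T \ T′ ↦ b ∈ T′ \ T`). -/
theorem finrank_inf_Sp_pairs_eq_of_card_eq {W : Submodule K (HT K (In N))} (hW : ∀ a b : Fin N, ∀ θ ∈ W, Pm K (swapMat K a b) θ ∈ W) {T T' : Finset (Fin N)}
    (h : T.card = T'.card) :
    finrank K ↥(W ⊓ Sp K (fun s : Finset (In N) => ∀ i ∈ s, pr i ∈ T)) = finrank K ↥(W ⊓ Sp K (fun s : Finset (In N) => ∀ i ∈ s, pr i ∈ T')) := by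
  classical
  induction hd : (T \ T').card generalizing T with
  | zero =>
    have hsub : T ⊆ T' := Finset.sdiff_eq_empty_iff_subset.mp (Finset.card_eq_zero.mp hd)
    rw [Finset.eq_of_subset_of_card_le hsub h.ge]
  | succ d ih =>
    -- `a ∈ T \ T'`, `b ∈ T' \ T`
    obtain ⟨a, ha⟩ : (T \ T').Nonempty := Finset.card_pos.mp (by omega)
    have hd' : (T' \ T).card = d + 1 := by rw [← card_sdiff_comm h, hd]
    obtain ⟨b, hb⟩ : (T' \ T).Nonempty := Finset.card_pos.mp (by omega)
    rw [Finset.mem_sdiff] at ha hb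
    -- one swap: `T ↦ T₁ = insert b (T \ {a})`
    rw [finrank_inf_Sp_pairs_swap K (hW a b) T, image_swap_eq_insert_erase ha.1 hb.2]
    have hbT : b ∉ T.erase a := fun h => hb.2 (Finset.mem_of_mem_erase h)
    refine ih (by rw [Finset.card_insert_of_notMem hbT, Finset.card_erase_of_mem ha.1, ← h]; have := Finset.card_pos.mpr ⟨a, ha.1⟩; omega) ?_
    rw [Finset.insert_sdiff_of_mem _ hb.1, Finset.erase_sdiff_comm, Finset.card_erase_of_mem (Finset.mem_sdiff.mpr ha), hd]
    rfl

/-- **TH-7's KERNELS: `dim (Kr(univ, w_N q, k) ⊓ Sp(pairs ⊆ T))` depends on `|T|` only** (I5: the kernel is stable under every pair mixing). -/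
theorem finrank_Kr_w_inf_Sp_pairs_eq_of_card_eq (q : ℕ → K) (k : ℕ) {T T' : Finset (Fin N)} (h : T.card = T'.card) :
    finrank K ↥(Kr K Finset.univ (w K N N q) k ⊓ Sp K (fun s : Finset (In N) => ∀ i ∈ s, pr i ∈ T)) =
      finrank K ↥(Kr K Finset.univ (w K N N q) k ⊓ Sp K (fun s : Finset (In N) => ∀ i ∈ s, pr i ∈ T')) :=
  finrank_inf_Sp_pairs_eq_of_card_eq K (fun a b _ hθ => Pm_mem_Kr_w K (swapMat K a b) q hθ) h

/-- **TH-7's IMAGES: `dim (V(univ, w_N q, k) ⊓ Sp(pairs ⊆ T))` depends on `|T|` only.** -/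
theorem finrank_V_w_inf_Sp_pairs_eq_of_card_eq (q : ℕ → K) (k : ℕ) {T T' : Finset (Fin N)} (h : T.card = T'.card) :
    finrank K ↥(V K (In N) Finset.univ (w K N N q) k ⊓ Sp K (fun s : Finset (In N) => ∀ i ∈ s, pr i ∈ T)) =
      finrank K ↥(V K (In N) Finset.univ (w K N N q) k ⊓ Sp K (fun s : Finset (In N) => ∀ i ∈ s, pr i ∈ T')) :=
  finrank_inf_Sp_pairs_eq_of_card_eq K (fun a b _ hv => Pm_mem_V_w K (swapMat K a b) q hv) h

/-- **THE DIMENSION OF THE IMAGE OF A KERNEL UNDER A PAIR MIXING DEPENDS ONLY ON THE RANK OF THE MIXING: `rank M = rank M′ ⇒ dim Pm(M)(Kr(univ, w_N q, k)) =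
dim Pm(M′)(Kr(univ, w_N q, k))`** (J14 reduces each to `dim (Kr ⊓ Sp(pairs ⊆ T))` with `|T| = rank`; §326 identifies the two). -/
theorem finrank_map_Pm_Kr_w_eq_of_rank_eq {M M' : Matrix (Fin N) (Fin N) K} (hMM' : M.rank = M'.rank) (q : ℕ → K) (k : ℕ) :
    finrank K ↥((Kr K Finset.univ (w K N N q) k).map (Pm K M).toLinearMap) = finrank K ↥((Kr K Finset.univ (w K N N q) k).map (Pm K M').toLinearMap) := by
  obtain ⟨T, hT, h⟩ := exists_finrank_map_Pm_Kr_w_eq K M q k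
  obtain ⟨T', hT', h'⟩ := exists_finrank_map_Pm_Kr_w_eq K M' q k
  rw [h, h']
  exact finrank_Kr_w_inf_Sp_pairs_eq_of_card_eq K q k (hT.trans (hMM'.trans hT'.symm))

end Summit.Ventures.HSemireg.Wedge.HankelPairMixing
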